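import Summits.SmoothPoincare4.SmoothPoincare4.Theorems.DottedCircleRasmussenDcrGapHelperFriendsCarrierVkPartBRayMono

/-!
# Helper `helper_friendsCarrier_Vk_partB_rayReparam` (piece of the registered stub
`helper_friendsCarrier_Vk_partB`, line `mk_friends`, skeleton v8) for crux `DcrGap`
(item stmt-SmoothPoincare4-16128, route route-SmoothPoincare4-DottedCircleRasmussen)

**The ray reparametrisation of the disc.**  From the level-parametrised radius `ρ` (smooth on the
annulus `|‖x‖ - 1| < τ`, `|ρ - 1| < 1/2`, `dρₓ(x) > 0`, `ρ = 1` on the circle — `…VkPartBRayRadius`)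
and the monotonicity datum of `…VkPartBRayMono` (the logarithmic cutoff `β` for which the blended
exponent has positive derivative along every ray) this file builds the map

  `R(x) = μ(x) x`,  `μ(x) = exp(β(‖x‖) (log ρ(x) - log ‖x‖)) = (ρ(x)/‖x‖)^{β(‖x‖)}`,

and proves: `R` is `C^∞` on the ball `‖x‖ < 1 + τ₁`; `R(x) = (ρ(x)/‖x‖) x` for `1 - τ₁ ≤ ‖x‖ < 1 + τ₁`
(there `β = 1`); `R = id` on the circle; `‖R x‖ < 1 ↔ ‖x‖ < 1`; `R(𝔻²) = 𝔻²`; `R` is injective on the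
ball and its differential is injective there.  Along the ray through a unit vector `u`,
`‖R(t u)‖ = t μ(t u) = exp E_u(t)` is strictly increasing (`E_u' > 0`), which gives injectivity, the
image, and — differentiating `R(s x) = (s μ(s x)) x` at `s = 1` — that `dRₓ(x)` is a POSITIVE multiple
of `x`, whence `dRₓ v = μ(x) v + (dμₓ v) x = 0` forces `v ∥ x` and then `v = 0`.

No definitions, no named facts, no `sorry`.
-/

-- the prescribed namespace `Summit.<P>.<Sub>.…` duplicates `SmoothPoincare4` (P = Sub)
set_option linter.dupNamespace false
set_option linter.style.longLine false

noncomputable section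

open scoped ContDiff Topology
open Set Function Metric Filter

namespace Summit.SmoothPoincare4.SmoothPoincare4.Theorems.DcrGap.MkFriends

namespace FriendsCarrierVk

/-- **Smoothness of the ray multiplier** `μ(x) = exp(β(‖x‖)(log ρ x - log ‖x‖))` on the ball
`‖x‖ < 1 + τ`: near the origin (`‖x‖ < 1 - τ/2`) it is identically `1`, on the annulus it is a smooth
formula. [folklore] -/
theorem contDiffAt_rayMul {ρ : (EuclideanSpace ℝ (Fin 2)) → ℝ} {β : ℝ → ℝ} {τ : ℝ} (hτh : τ ≤ 1 / 2)
    (hρs : ∀ x : (EuclideanSpace ℝ (Fin 2)), |‖x‖ - 1| < τ → ContDiffAt ℝ ∞ ρ x) (hρpos : ∀ x : (EuclideanSpace ℝ (Fin 2)), |‖x‖ - 1| < τ → 0 < ρ x)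
    (hβs : ContDiff ℝ ∞ β) (hβzero : ∀ t, t ≤ 1 - τ / 2 → β t = 0) {x : (EuclideanSpace ℝ (Fin 2))} (hx : ‖x‖ < 1 + τ) :
    ContDiffAt ℝ ∞ (fun y : (EuclideanSpace ℝ (Fin 2)) => Real.exp (β ‖y‖ * (Real.log (ρ y) - Real.log ‖y‖))) x := by
  by_cases h : ‖x‖ < 1 - τ / 2
  · have hev : (fun y : (EuclideanSpace ℝ (Fin 2)) => Real.exp (β ‖y‖ * (Real.log (ρ y) - Real.log ‖y‖))) =ᶠ[𝓝 x] fun _ => (1 : ℝ) := by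
      filter_upwards [(isOpen_lt continuous_norm continuous_const).mem_nhds h] with y hy
      simp only [hβzero ‖y‖ (le_of_lt hy), zero_mul, Real.exp_zero]
    exact contDiffAt_const.congr_of_eventuallyEq hev
  · have hxa : |‖x‖ - 1| < τ := by rw [abs_lt]; push Not at h; constructor <;> linarith
    have hx0 : x ≠ 0 := by
      intro h0; rw [h0, norm_zero] at h; push Not at h; linarith
    have h1 : ContDiffAt ℝ ∞ (fun y : (EuclideanSpace ℝ (Fin 2)) => ‖y‖) x := contDiffAt_norm ℝ hx0
    have h2 : ContDiffAt ℝ ∞ (fun y : (EuclideanSpace ℝ (Fin 2)) => β ‖y‖) x := hβs.contDiffAt.comp x h1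
    have h3 : ContDiffAt ℝ ∞ (fun y => Real.log (ρ y)) x := (hρs x hxa).log (hρpos x hxa).ne'
    have h4 : ContDiffAt ℝ ∞ (fun y : (EuclideanSpace ℝ (Fin 2)) => Real.log ‖y‖) x := h1.log (norm_ne_zero_iff.2 hx0)
    exact Real.contDiff_exp.contDiffAt.comp x (h2.mul (h3.sub h4))

/-- **The blended radius along a ray** `r(t) = t μ(t u)` (`u` a unit vector): continuous and strictly
increasing on `[0, 1 + τ₁)`, with positive derivative on `(0, 1 + τ₁)`, `r(0) = 0`, `r(1) = 1`.
[folklore] -/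
theorem ray_props {ρ : (EuclideanSpace ℝ (Fin 2)) → ℝ} {β : ℝ → ℝ} {τ τ₁ : ℝ} (hτh : τ ≤ 1 / 2) (hτ₁ : 0 < τ₁) (hτ₁τ : τ₁ < τ / 2)
    (hρs : ∀ x : (EuclideanSpace ℝ (Fin 2)), |‖x‖ - 1| < τ → ContDiffAt ℝ ∞ ρ x) (hρpos : ∀ x : (EuclideanSpace ℝ (Fin 2)), |‖x‖ - 1| < τ → 0 < ρ x)
    (hone : ∀ x : (EuclideanSpace ℝ (Fin 2)), ‖x‖ = 1 → ρ x = 1)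
    (hβs : ContDiff ℝ ∞ β) (hβzero : ∀ t, t ≤ 1 - τ / 2 → β t = 0)
    (hmono : ∀ (u : (EuclideanSpace ℝ (Fin 2))), ‖u‖ = 1 → ∀ t : ℝ, 1 - τ / 2 ≤ t → t < 1 + τ₁ →
      ∃ e : ℝ, 0 < e ∧ HasDerivAt (fun t : ℝ => Real.log t + β t * (Real.log (ρ (t • u)) - Real.log t)) e t)
    {u : (EuclideanSpace ℝ (Fin 2))} (hu : ‖u‖ = 1) :
    ContinuousOn (fun t : ℝ => t * Real.exp (β ‖t • u‖ * (Real.log (ρ (t • u)) - Real.log ‖t • u‖))) (Ico 0 (1 + τ₁)) ∧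
    StrictMonoOn (fun t : ℝ => t * Real.exp (β ‖t • u‖ * (Real.log (ρ (t • u)) - Real.log ‖t • u‖))) (Ico 0 (1 + τ₁)) ∧
    (∀ t : ℝ, 0 < t → t < 1 + τ₁ → ∃ d : ℝ, 0 < d ∧
      HasDerivAt (fun t : ℝ => t * Real.exp (β ‖t • u‖ * (Real.log (ρ (t • u)) - Real.log ‖t • u‖))) d t) ∧
    (0 : ℝ) * Real.exp (β ‖(0 : ℝ) • u‖ * (Real.log (ρ ((0 : ℝ) • u)) - Real.log ‖(0 : ℝ) • u‖)) = 0 ∧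
    (1 : ℝ) * Real.exp (β ‖(1 : ℝ) • u‖ * (Real.log (ρ ((1 : ℝ) • u)) - Real.log ‖(1 : ℝ) • u‖)) = 1 := by
  set μ : (EuclideanSpace ℝ (Fin 2)) → ℝ := fun y => Real.exp (β ‖y‖ * (Real.log (ρ y) - Real.log ‖y‖)) with hμ
  set r : ℝ → ℝ := fun t => t * μ (t • u) with hr
  have hn : ∀ t : ℝ, 0 ≤ t → ‖t • u‖ = t := fun t ht => by
    rw [norm_smul, hu, mul_one, Real.norm_eq_abs, abs_of_nonneg ht]
  -- continuity
  have hμc : ∀ t : ℝ, 0 ≤ t → t < 1 + τ₁ → ContinuousAt μ (t • u) := fun t ht0 ht =>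
    (contDiffAt_rayMul hτh hρs hρpos hβs hβzero (by rw [hn t ht0]; linarith)).continuousAt
  have hcont : ContinuousOn r (Ico 0 (1 + τ₁)) := by
    intro t ht
    have h1 : ContinuousAt (fun t : ℝ => t • u) t := (continuous_id.smul continuous_const).continuousAt
    exact (continuousAt_id.mul ((hμc t ht.1 ht.2).comp_of_eq h1 rfl)).continuousWithinAt
  -- the derivative
  have hderiv : ∀ t : ℝ, 0 < t → t < 1 + τ₁ → ∃ d : ℝ, 0 < d ∧ HasDerivAt r d t := by
    intro t ht0 ht
    by_cases hcase : t < 1 - τ / 2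
    · -- near this `t` the ray function is the identity
      refine ⟨1, one_pos, ?_⟩
      have hev : r =ᶠ[𝓝 t] id := by
        filter_upwards [Ioo_mem_nhds ht0 hcase] with s hs
        simp only [hr, hμ, hn s hs.1.le, hβzero s hs.2.le, zero_mul, Real.exp_zero, mul_one, id]
      exact (hasDerivAt_id t).congr_of_eventuallyEq hev
    · push Not at hcase
      obtain ⟨e, he, hE⟩ := hmono u hu t hcase ht
      refine ⟨Real.exp (Real.log t + β t * (Real.log (ρ (t • u)) - Real.log t)) * e, mul_pos (Real.exp_pos _) he, ?_⟩
      have hev : r =ᶠ[𝓝 t] fun s => Real.exp (Real.log s + β s * (Real.log (ρ (s • u)) - Real.log s)) := by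
        filter_upwards [Ioi_mem_nhds ht0] with s hs
        simp only [hr, hμ, hn s (le_of_lt hs)]
        rw [Real.exp_add, Real.exp_log hs]
      exact hE.exp.congr_of_eventuallyEq hev
  -- strict monotonicity
  have hmonoOn : StrictMonoOn r (Ico 0 (1 + τ₁)) := by
    refine strictMonoOn_of_deriv_pos (convex_Ico _ _) hcont fun t ht => ?_
    rw [interior_Ico] at ht
    obtain ⟨d, hd, hD⟩ := hderiv t ht.1 ht.2
    rwa [hD.deriv]
  refine ⟨hcont, hmonoOn, hderiv, by simp, ?_⟩
  rw [one_smul, hu, hone u hu, Real.log_one, sub_self, mul_zero, Real.exp_zero, mul_one]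

set_option maxHeartbeats 800000 in
/-- **The ray reparametrisation.**  For `ρ` smooth on the annulus `|‖x‖ - 1| < τ` (`0 < τ ≤ 1/2`) with
`|ρ - 1| < 1/2`, positive radial derivative and `ρ = 1` on the unit circle, there are `τ₁ ∈ (0, τ/2)` and
`R : ℝ² → ℝ²` with: `R` is `C^∞` on `‖x‖ < 1 + τ₁`; `R x = (ρ x/‖x‖) • x` for `1 - τ₁ ≤ ‖x‖ < 1 + τ₁`;
`R x = x` on the circle; `‖R x‖ < 1 ↔ ‖x‖ < 1` on the ball; `R '' 𝔻² = 𝔻²`; `R` is injective on the ball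
`‖x‖ < 1 + τ₁` with injective differential there. [folklore] -/
theorem exists_rayReparam {ρ : (EuclideanSpace ℝ (Fin 2)) → ℝ} {τ : ℝ} (hτ : 0 < τ) (hτh : τ ≤ 1 / 2)
    (hρs : ∀ x : (EuclideanSpace ℝ (Fin 2)), |‖x‖ - 1| < τ → ContDiffAt ℝ ∞ ρ x)
    (hρ1 : ∀ x : (EuclideanSpace ℝ (Fin 2)), |‖x‖ - 1| < τ → |ρ x - 1| < 1 / 2)
    (hρd : ∀ x : (EuclideanSpace ℝ (Fin 2)), |‖x‖ - 1| < τ → 0 < fderiv ℝ ρ x x)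
    (hone : ∀ x : (EuclideanSpace ℝ (Fin 2)), ‖x‖ = 1 → ρ x = 1) :
    ∃ (R : (EuclideanSpace ℝ (Fin 2)) → (EuclideanSpace ℝ (Fin 2))) (τ₁ : ℝ), 0 < τ₁ ∧ τ₁ < τ / 2 ∧
      (∀ x : (EuclideanSpace ℝ (Fin 2)), ‖x‖ < 1 + τ₁ → ContDiffAt ℝ ∞ R x) ∧
      (∀ x : (EuclideanSpace ℝ (Fin 2)), 1 - τ₁ ≤ ‖x‖ → ‖x‖ < 1 + τ₁ → R x = (ρ x * ‖x‖⁻¹) • x) ∧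
      (∀ x : (EuclideanSpace ℝ (Fin 2)), ‖x‖ = 1 → R x = x) ∧
      (∀ x : (EuclideanSpace ℝ (Fin 2)), ‖x‖ < 1 + τ₁ → (‖R x‖ < 1 ↔ ‖x‖ < 1)) ∧
      R '' closedBall 0 1 = closedBall 0 1 ∧
      InjOn R (ball 0 (1 + τ₁)) ∧
      (∀ x : (EuclideanSpace ℝ (Fin 2)), ‖x‖ < 1 + τ₁ → Injective (fderiv ℝ R x)) := by
  have hρpos : ∀ x : (EuclideanSpace ℝ (Fin 2)), |‖x‖ - 1| < τ → 0 < ρ x := fun x hx => by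
    have := abs_lt.1 (hρ1 x hx); linarith
  obtain ⟨β, τ₁, hτ₁, hτ₁τ, hβs, hβ01, hβzero, hβone, hmono⟩ := exists_rayMono hτ hτh hρs hρ1 hρd hone
  set μ : (EuclideanSpace ℝ (Fin 2)) → ℝ := fun y => Real.exp (β ‖y‖ * (Real.log (ρ y) - Real.log ‖y‖)) with hμ
  set R : (EuclideanSpace ℝ (Fin 2)) → (EuclideanSpace ℝ (Fin 2)) := fun x => μ x • x with hR
  have hμpos : ∀ x, 0 < μ x := fun x => Real.exp_pos _
  have hμs : ∀ x : (EuclideanSpace ℝ (Fin 2)), ‖x‖ < 1 + τ₁ → ContDiffAt ℝ ∞ μ x := fun x hx =>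
    contDiffAt_rayMul hτh hρs hρpos hβs hβzero (by linarith)
  have hRs : ∀ x : (EuclideanSpace ℝ (Fin 2)), ‖x‖ < 1 + τ₁ → ContDiffAt ℝ ∞ R x := fun x hx => (hμs x hx).smul contDiffAt_id
  -- the unit vector of a nonzero point and the ray function through it
  have hunit : ∀ x : (EuclideanSpace ℝ (Fin 2)), x ≠ 0 → ‖‖x‖⁻¹ • x‖ = 1 ∧ ‖x‖ • (‖x‖⁻¹ • x) = x := fun x hx => by
    have h0 : ‖x‖ ≠ 0 := norm_ne_zero_iff.2 hx
    exact ⟨by rw [norm_smul, norm_inv, norm_norm, inv_mul_cancel₀ h0], by rw [smul_smul, mul_inv_cancel₀ h0, one_smul]⟩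
  have hray := fun (u : (EuclideanSpace ℝ (Fin 2))) (hu : ‖u‖ = 1) => ray_props hτh hτ₁ hτ₁τ hρs hρpos hone hβs hβzero hmono hu
  -- `‖R x‖` is the ray function at `‖x‖`
  have hnormR : ∀ x : (EuclideanSpace ℝ (Fin 2)), ‖R x‖ = ‖x‖ * μ x := fun x => by
    simp only [hR, norm_smul, Real.norm_eq_abs, abs_of_pos (hμpos x), mul_comm]
  have hnormR' : ∀ x : (EuclideanSpace ℝ (Fin 2)), x ≠ 0 →
      ‖R x‖ = ‖x‖ * Real.exp (β ‖‖x‖ • (‖x‖⁻¹ • x)‖ * (Real.log (ρ (‖x‖ • (‖x‖⁻¹ • x))) - Real.log ‖‖x‖ • (‖x‖⁻¹ • x)‖)) := by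
    intro x hx
    rw [(hunit x hx).2, hnormR x]
  -- `R = id` on the circle, and the formula on the band
  have hcirc : ∀ x : (EuclideanSpace ℝ (Fin 2)), ‖x‖ = 1 → R x = x := by
    intro x hx
    simp only [hR, hμ, hx, hβone 1 (by linarith), hone x hx, Real.log_one, sub_self, mul_zero, Real.exp_zero, one_smul]
  have hband : ∀ x : (EuclideanSpace ℝ (Fin 2)), 1 - τ₁ ≤ ‖x‖ → ‖x‖ < 1 + τ₁ → R x = (ρ x * ‖x‖⁻¹) • x := by
    intro x h1 h2
    have hx0 : 0 < ‖x‖ := by linarith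
    have hxa : |‖x‖ - 1| < τ := by rw [abs_lt]; constructor <;> linarith
    simp only [hR, hμ, hβone _ h1, one_mul, Real.exp_sub, Real.exp_log (hρpos x hxa), Real.exp_log hx0, div_eq_mul_inv]
  -- norms
  have hlt_iff : ∀ x : (EuclideanSpace ℝ (Fin 2)), ‖x‖ < 1 + τ₁ → (‖R x‖ < 1 ↔ ‖x‖ < 1) := by
    intro x hx
    by_cases hx0 : x = 0
    · subst hx0; simp [hR]
    · obtain ⟨-, hsm, -, -, h1⟩ := hray _ (hunit x hx0).1
      have key := hsm.lt_iff_lt ⟨norm_nonneg _, hx⟩ ⟨zero_le_one, by linarith⟩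
      rw [h1, ← hnormR' x hx0] at key
      exact key
  have hle_iff : ∀ x : (EuclideanSpace ℝ (Fin 2)), ‖x‖ < 1 + τ₁ → (‖R x‖ ≤ 1 ↔ ‖x‖ ≤ 1) := by
    intro x hx
    by_cases hx0 : x = 0
    · subst hx0; simp [hR]
    · obtain ⟨-, hsm, -, -, h1⟩ := hray _ (hunit x hx0).1
      have key := hsm.le_iff_le ⟨norm_nonneg _, hx⟩ ⟨zero_le_one, by linarith⟩
      rw [h1, ← hnormR' x hx0] at key
      exact key
  -- the image of the closed disc
  have himage : R '' closedBall 0 1 = closedBall 0 1 := by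
    apply subset_antisymm
    · rintro _ ⟨x, hx, rfl⟩
      rw [mem_closedBall_zero_iff] at hx ⊢
      exact (hle_iff x (by linarith)).2 hx
    · intro y hy
      rw [mem_closedBall_zero_iff] at hy
      by_cases hy0 : y = 0
      · exact ⟨0, by simp, by simp [hR, hy0]⟩
      · obtain ⟨hu1, hyu⟩ := hunit y hy0
        set u : (EuclideanSpace ℝ (Fin 2)) := ‖y‖⁻¹ • y with hudef
        obtain ⟨hcont, -, -, h0, h1⟩ := hray u hu1
        have hivt := intermediate_value_Icc zero_le_one (hcont.mono (Icc_subset_Ico_right (by linarith)))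
        rw [h0, h1] at hivt
        obtain ⟨s, hs, hsy⟩ := hivt ⟨norm_nonneg y, hy⟩
        refine ⟨s • u, mem_closedBall_zero_iff.2 ?_, ?_⟩
        · rw [norm_smul, hu1, mul_one, Real.norm_eq_abs, abs_of_nonneg hs.1]; exact hs.2
        · show μ (s • u) • (s • u) = y
          rw [smul_smul, mul_comm]
          simp only at hsy
          rw [hsy, hyu]
  -- injectivity
  have hinj : InjOn R (ball 0 (1 + τ₁)) := by
    intro x hx y hy hxy
    rw [mem_ball_zero_iff] at hx hy
    have hxy' : μ x • x = μ y • y := hxy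
    by_cases hx0 : x = 0
    · subst hx0
      rw [smul_zero, eq_comm, smul_eq_zero] at hxy'
      exact (hxy'.resolve_left (hμpos y).ne').symm
    by_cases hy0 : y = 0
    · subst hy0
      rw [smul_zero, smul_eq_zero] at hxy'
      exact hxy'.resolve_left (hμpos x).ne'
    -- `y` is a positive multiple of `x`
    set a : ℝ := μ x / μ y with ha
    have hapos : 0 < a := div_pos (hμpos x) (hμpos y)
    have hyx : y = a • x := by
      rw [ha, div_eq_inv_mul, mul_smul, hxy', smul_smul, inv_mul_cancel₀ (hμpos y).ne', one_smul]
    obtain ⟨hu1, hxu⟩ := hunit x hx0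
    set u : (EuclideanSpace ℝ (Fin 2)) := ‖x‖⁻¹ • x with hudef
    obtain ⟨-, hsm, -, -, -⟩ := hray u hu1
    have hny : ‖y‖ = a * ‖x‖ := by rw [hyx, norm_smul, Real.norm_eq_abs, abs_of_pos hapos]
    have hyu : ‖y‖ • u = y := by
      rw [hny, hudef, smul_smul, mul_assoc, mul_inv_cancel₀ (norm_ne_zero_iff.2 hx0), mul_one, hyx]
    have hnorm : ‖R x‖ = ‖R y‖ := by rw [hxy]
    rw [hnormR x, hnormR y] at hnorm
    have h1 : ‖x‖ * μ x = ‖x‖ * μ (‖x‖ • u) := by rw [hxu]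
    have h2 : ‖y‖ * μ y = ‖y‖ * μ (‖y‖ • u) := by rw [hyu]
    rw [h1, h2] at hnorm
    have heq : ‖x‖ = ‖y‖ := hsm.injOn ⟨norm_nonneg _, hx⟩ ⟨norm_nonneg _, hy⟩ hnorm
    have ha1 : a = 1 := by
      have hxpos : 0 < ‖x‖ := norm_pos_iff.2 hx0
      have : a * ‖x‖ = 1 * ‖x‖ := by rw [← hny, ← heq, one_mul]
      exact mul_right_cancel₀ hxpos.ne' this
    rw [hyx, ha1, one_smul]
  -- the differential
  have himm : ∀ x : (EuclideanSpace ℝ (Fin 2)), ‖x‖ < 1 + τ₁ → Injective (fderiv ℝ R x) := by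
    intro x hx
    by_cases hx0 : x = 0
    · -- near the origin `R` is the identity
      have hev : R =ᶠ[𝓝 x] id := by
        have ho : IsOpen {y : (EuclideanSpace ℝ (Fin 2)) | ‖y‖ < 1 - τ / 2} := isOpen_lt continuous_norm continuous_const
        have hmem : x ∈ {y : (EuclideanSpace ℝ (Fin 2)) | ‖y‖ < 1 - τ / 2} := by
          show ‖x‖ < 1 - τ / 2; rw [hx0, norm_zero]; linarith
        filter_upwards [ho.mem_nhds hmem] with y hy
        simp only [hR, hμ, hβzero ‖y‖ (le_of_lt hy), zero_mul, Real.exp_zero, one_smul, id]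
      rw [hev.fderiv_eq, fderiv_id]
      exact injective_id
    · -- the derivative `L v = μ x • v + (dμ v) • x`
      have hμd : HasFDerivAt μ (fderiv ℝ μ x) x := ((hμs x hx).differentiableAt (by simp)).hasFDerivAt
      have hL : HasFDerivAt R (μ x • ContinuousLinearMap.id ℝ (EuclideanSpace ℝ (Fin 2)) + (fderiv ℝ μ x).smulRight x) x :=
        hμd.fun_smul (hasFDerivAt_id x)
      rw [hL.fderiv]
      -- along the ray, `L x` is a positive multiple of `x`
      obtain ⟨hu1, hxu⟩ := hunit x hx0
      set u : (EuclideanSpace ℝ (Fin 2)) := ‖x‖⁻¹ • x with hudef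
      set t₀ : ℝ := ‖x‖ with ht₀
      have ht₀pos : 0 < t₀ := norm_pos_iff.2 hx0
      obtain ⟨-, -, hder, -, -⟩ := hray u hu1
      obtain ⟨d, hd, hD⟩ := hder t₀ ht₀pos hx
      -- `ψ s = R (s • x)` two ways
      have hψ1 : HasDerivAt (fun s : ℝ => R (s • x)) ((μ x • ContinuousLinearMap.id ℝ (EuclideanSpace ℝ (Fin 2)) + (fderiv ℝ μ x).smulRight x) x) 1 := by
        have hline : HasDerivAt (fun s : ℝ => s • x) x 1 := by simpa using (hasDerivAt_id (1 : ℝ)).smul_const x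
        exact hL.comp_hasDerivAt_of_eq 1 hline (one_smul ℝ x).symm
      have hψ2 : HasDerivAt (fun s : ℝ => R (s • x)) ((d * t₀ / t₀) • x) 1 := by
        -- `R (s • x) = (r (s t₀) / t₀) • x`
        have hev : (fun s : ℝ => R (s • x)) =ᶠ[𝓝 1] fun s =>
            ((s * t₀) * Real.exp (β ‖(s * t₀) • u‖ * (Real.log (ρ ((s * t₀) • u)) - Real.log ‖(s * t₀) • u‖)) / t₀) • x := by
          filter_upwards [Ioi_mem_nhds (zero_lt_one' ℝ)] with s hs
          have hsx : (s * t₀) • u = s • x := by rw [mul_smul, hxu]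
          rw [hsx]
          show μ (s • x) • (s • x) = ((s * t₀) * μ (s • x) / t₀) • x
          have hcoef : (s * t₀) * μ (s • x) / t₀ = μ (s • x) * s := by
            field_simp
          rw [hcoef, smul_smul]
        have h1 : HasDerivAt (fun s : ℝ => s * t₀) t₀ 1 := by simpa using (hasDerivAt_id (1 : ℝ)).mul_const t₀
        have h2 : HasDerivAt (fun s : ℝ => (s * t₀) * Real.exp (β ‖(s * t₀) • u‖ * (Real.log (ρ ((s * t₀) • u)) - Real.log ‖(s * t₀) • u‖)))
            (d * t₀) 1 := by
          have hD' : HasDerivAt (fun t : ℝ => t * Real.exp (β ‖t • u‖ * (Real.log (ρ (t • u)) - Real.log ‖t • u‖))) d (1 * t₀) := by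
            rwa [one_mul]
          exact hD'.comp 1 h1
        exact ((h2.div_const t₀).smul_const x).congr_of_eventuallyEq hev
      have hLx : (μ x • ContinuousLinearMap.id ℝ (EuclideanSpace ℝ (Fin 2)) + (fderiv ℝ μ x).smulRight x) x = d • x := by
        have := hψ1.unique hψ2
        rwa [mul_div_assoc, div_self ht₀pos.ne', mul_one] at this
      -- injectivity
      refine (injective_iff_map_eq_zero _).2 fun v hv => ?_
      have hv' : μ x • v + (fderiv ℝ μ x v) • x = 0 := by simpa using hv
      set c : ℝ := -(fderiv ℝ μ x v) / μ x with hc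
      have hvc : v = c • x := by
        have h1 : v = (μ x)⁻¹ • (-(fderiv ℝ μ x v • x)) := by
          rw [eq_inv_smul_iff₀ (hμpos x).ne', eq_neg_iff_add_eq_zero]; exact hv'
        rw [h1, hc, div_eq_inv_mul, mul_smul, neg_smul]
      have hcd : (c * d) • x = 0 := by
        have : (μ x • ContinuousLinearMap.id ℝ (EuclideanSpace ℝ (Fin 2)) + (fderiv ℝ μ x).smulRight x) (c • x) = 0 := by rw [← hvc]; exact hv
        rw [map_smul, hLx, smul_smul] at this
        exact this
      rw [smul_eq_zero] at hcd
      have hc0 : c = 0 := by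
        rcases hcd with h | h
        · exact (mul_eq_zero.1 h).resolve_right hd.ne'
        · exact absurd h hx0
      rw [hvc, hc0, zero_smul]
  exact ⟨R, τ₁, hτ₁, hτ₁τ, hRs, hband, hcirc, hlt_iff, himage, hinj, himm⟩

end FriendsCarrierVk

open FriendsCarrierVk in
/-- **Helper `helper_friendsCarrier_Vk_partB_rayReparam`** (piece of the registered stub
`helper_friendsCarrier_Vk_partB`: the ray reparametrisation of the disc).  For `ρ` smooth on the annulus
`|‖x‖ - 1| < τ` with `|ρ - 1| < 1/2`, positive radial derivative and `ρ = 1` on the circle, there is a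
map `R` of the plane, `C^∞` on `‖x‖ < 1 + τ₁`, equal to `x ↦ ρ(x) x/‖x‖` on `1 - τ₁ ≤ ‖x‖ < 1 + τ₁`,
fixing the circle, with `‖R x‖ < 1 ↔ ‖x‖ < 1`, `R(𝔻²) = 𝔻²`, injective with injective differential on
the ball. [folklore] -/
theorem helper_friendsCarrier_Vk_partB_rayReparam : ∀ (ρ : EuclideanSpace ℝ (Fin 2) → ℝ) (τ : ℝ), 0 < τ → τ ≤ 1 / 2 → (∀ x : EuclideanSpace ℝ (Fin 2), |‖x‖ - 1| < τ → ContDiffAt ℝ ((⊤ : ℕ∞) : WithTop ℕ∞) ρ x) → (∀ x : EuclideanSpace ℝ (Fin 2), |‖x‖ - 1| < τ → |ρ x - 1| < 1 / 2) → (∀ x : EuclideanSpace ℝ (Fin 2), |‖x‖ - 1| < τ → 0 < fderiv ℝ ρ x x) → (∀ x : EuclideanSpace ℝ (Fin 2), ‖x‖ = 1 → ρ x = 1) → ∃ (R : EuclideanSpace ℝ (Fin 2) → EuclideanSpace ℝ (Fin 2)) (τ₁ : ℝ), 0 < τ₁ ∧ τ₁ < τ / 2 ∧ (∀ x : EuclideanSpace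 ℝ (Fin 2), ‖x‖ < 1 + τ₁ → ContDiffAt ℝ ((⊤ : ℕ∞) : WithTop ℕ∞) R x) ∧ (∀ x : EuclideanSpace ℝ (Fin 2), 1 - τ₁ ≤ ‖x‖ → ‖x‖ < 1 + τ₁ → R x = (ρ x * ‖x‖⁻¹) • x) ∧ (∀ x : EuclideanSpace ℝ (Fin 2), ‖x‖ = 1 → R x = x) ∧ (∀ x : EuclideanSpace ℝ (Fin 2), ‖x‖ < 1 + τ₁ → (‖R x‖ < 1 ↔ ‖x‖ < 1)) ∧ R '' Metric.closedBall 0 1 = Metric.closedBall 0 1 ∧ Set.InjOn R (Metric.ball 0 (1 + τ₁)) ∧ (∀ x : EuclideanSpace ℝ (Fin 2), ‖x‖ < 1 + τ₁ → Function.Injective (fderiv ℝ R x)) :=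
  fun _ _ hτ hτh hρs hρ1 hρd hone => exists_rayReparam hτ hτh hρs hρ1 hρd hone

end Summit.SmoothPoincare4.SmoothPoincare4.Theorems.DcrGap.MkFriends

end
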